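import Literature.Analysis.FluidPDE.NSEnstrophyPersistence
import Literature.Analysis.FluidPDE.ClassicalSolutionGlue
import HarnessLib

/-!
# `H¹`-bounded classical Navier–Stokes solutions on `ℝ³`: dissipation of the vorticity gradient
# (the level-zero step of the vorticity energy method) and instantaneous Sobolev smoothing

Analysis/FluidPDE support file for the continuation route to Tao 2011, Cor. 11.1 with `H¹`
data (`Literature.Analysis.FluidPDE.tao2011_boundedEnstrophy`). The persistence files
(`NSVorticitySlice`, `NSEnstrophyPersistence`) run the localised vorticity energy method from
level `n ≥ 1` upwards, *starting* from `u ∈ X¹ = L^∞_t H¹_x ∩ L²_t H²_x`. This file supplies the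
missing level-zero step in the form needed by continuation arguments with `H¹` data: for an
unforced classical solution `u` on the closed slab `[0, T] × ℝ³` (`ν > 0`) which is merely
**`H¹`-bounded** — `sup_{t ∈ [0,T]} ∫ |u(t)|² < ∞` and `sup_{t ∈ [0,T]} ∫ |∇u(t)|² < ∞` — the
localised `L²_t` norms `∫₀ᵀ ∫ χ_R² |∇²u|²` are bounded uniformly in `R ≥ 1`
(`IsClassicalNSSolutionOn.dissipation_of_h1Bounded`), hence `∫₀ᵀ ∫ ‖D²u‖² < ∞` and
`u ∈ X¹([0, T] × ℝ³)` (`IsClassicalNSSolutionOn.memSobolevX_of_h1Bounded`): the `L²_t H²_x` half of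
`X¹` is *recovered* from the `L^∞_t H¹_x` half. Consequently (restarting the persistence step
`IsClassicalNSSolutionOn.sobolev_step` of `NSEnstrophyPersistence` at almost-every-time `H^k` data,
the system being autonomous) such a solution has **all Sobolev norms bounded on `[ε, T]` for
every `ε > 0`** (`IsClassicalNSSolutionOn.hasBoundedSobolevNormsOn_of_h1Bounded`, instantaneous
parabolic smoothing in the Sobolev scale), which is what the strong-class total speed bound
`tao2011_boundedTotalSpeed_of_hasBoundedSobolevNormsOn` (`NSStrongSpeedBound`) consumes.

## The argument

The level-zero slice inequality `∂ₜ ∫ χ_R⁴|Ω|² ≤ −ν ∫ χ_R⁴|∇Ω|² + C₀ (1 + ∫ χ_R⁴|Ω|² + ∫ χ_R²|∇u|²)`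
(`slice_energy_inequality_zero`), with `C₀` depending only on `ν`, the cutoff gradient bound and
the two global bounds `S₀ ≥ ∫|u|²`, `S₁ ≥ ∫|∇u|²`: the viscous and transport pairings are those of
`NSVorticitySlice` (`component_pairing_le`, `transport_term_le`, valid at every level); the
vortex-stretching forcing `|F| ≤ 12 |∇u|²` of the vorticity equation gives the cubic term
`∫ χ⁴ |∇u|² |Ω|`, bounded by the trilinear Hölder–Gagliardo–Nirenberg–Sobolev piece of
`NSVorticitySlice` (`forcing_trilinear_piece` with `a = b = 1`, `n = 0`: the global factor is
`‖∇u‖₂ ≤ S₁^{1/2}`), the top-order factor `∫ χ⁴|∇²u|²` is returned to `∫ χ⁴|∇Ω|²` by the weighted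
div–curl inequality, and everything is absorbed into the dissipation (`exists_eps_absorb_four`)
— this closes precisely because the `H¹` bound is a *hypothesis* (at level zero the energy
method cannot produce it). Time integration and Grönwall exactly as in
`NSEnstrophyPersistence.uniform_enstrophy_bounds`, then exhaustion `R → ∞` (in space by monotone
convergence over balls, in space–time by `lintegral_iSup'` with the time-measurability supplied
by joint continuity on the slab). Smoothing: `∫₀ᵀ∫|∇^{n+1}u|² < ∞` makes almost every time an
`H^{n+1}` time (`exists_integrable_levelSq`); translating the solution to such a time
(`translate_Icc_zero`) the tree's `sobolev_step` applies, and an induction on `n` restarted at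
`b/2` gives every level on `[b, T]`, `b > 0` (`sobolevLevels_of_h1Bounded`).

No new definitions. All statements are folklore (the classical enstrophy balance, Majda–Bertozzi
2002, §3.2; Doering–Gibbon 1995, §6.1–6.2), localised with cutoffs because no spatial decay of
the second derivatives of a classical solution is assumed.

## Mathlib / tree search

`lean search 'slice_energy_inequality|uniform_enstrophy_bounds|sobolev_step'`: the tree's
versions all require `1 ≤ n` (`NSVorticitySlice`, `NSEnstrophyPersistence`);
`NSStrongSpeedBound.enstrophy_pairing_le` is a level-zero pairing but needs the *global*
`∫|∇²u|² < ∞` and a velocity bound, which an `H¹`-bounded solution does not provide a priori.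
Mathlib: `MeasureTheory.lintegral_iSup'`, `MeasureTheory.ae_lt_top'`, `AEMeasurable.lintegral_prod_right'`,
`MeasurePreserving.setIntegral_preimage_emb` (translation of set integrals), `ae_neBot`.
Tree: `IsClassicalNSSolutionOn.comp_add_right` (`ClassicalSolutionGlue`), `sobolev_step`,
`integral_Ioo_cutoff_levelSq_le_of_uniform`, `lintegral_sq_norm_iteratedFDeriv_le`
(`NSEnstrophyPersistence`), `forcing_trilinear_piece`, `transport_term_le`, `component_pairing_le`,
`exists_eps_absorb_four` (`NSVorticitySlice`), `aestronglyMeasurable_prod_of_continuousOn`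
(`ClassicalSolutionCalculus`).

## References

* A. J. Majda, A. L. Bertozzi, *Vorticity and Incompressible Flow*, CUP (2002)
  (`MajdaBertozzi2002`), §3.2, Prop. 3.7 and (3.58) (the energy method). [folklore]
* C. R. Doering, J. D. Gibbon, *Applied Analysis of the Navier–Stokes Equations*, CUP (1995)
  (`DoeringGibbon1995`), §6.1–6.2 (enstrophy balance, `‖∇u‖₂ = ‖ω‖₂`, the ladder). [folklore]
* T. Tao, arXiv:1108.1165 = Anal. PDE 6 (2013) (`Tao2011`), Cor. 11.1 (the statement served).
-/

noncomputable section

open MeasureTheory Set Function Filter Topology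
open scoped ENNReal NNReal ContDiff BigOperators

namespace Literature.Analysis.FluidPDE

/-! ## The level-zero forcing term -/

section SliceZero

variable {v : EuclideanSpace ℝ (Fin 3) → EuclideanSpace ℝ (Fin 3)} {φ : EuclideanSpace ℝ (Fin 3) → ℝ}

/-- **Reduction of the level-zero forcing terms**: if `|F_c| ≤ C_F |∇v|²` pointwise then
`∑_c 2 ∫ φ⁴ Ω_c F_c ≤ 2 · #c · C_F ∫ φ⁴ |∇v| |∇v| |Ω|` (`|Ω_{ki}| ≤ |Ω|`). [folklore] -/
theorem forcing_reduction_zero {CF : ℝ} (hv : ContDiff ℝ ∞ v)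
    (hφ : ContDiff ℝ ∞ φ) (hφc : HasCompactSupport φ) (hφ0 : ∀ x, 0 ≤ φ x)
    {F : (Fin 0 → Fin 3) × Fin 3 × Fin 3 → EuclideanSpace ℝ (Fin 3) → ℝ}
    (hFc : ∀ c', Continuous (F c')) (hF : ∀ c' x, |F c' x| ≤ CF * levelSq 1 v x) :
    ∑ c', 2 * ∫ x, φ x ^ 4 * (vortFam 0 v c' x * F c' x) ≤
      2 * (Fintype.card ((Fin 0 → Fin 3) × Fin 3 × Fin 3) : ℝ) * CF *
        ∫ x, φ x ^ 4 * (Real.sqrt (levelSq 1 v x) * Real.sqrt (levelSq 1 v x) *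
          Real.sqrt (vortSq 0 v x)) := by
  have hφcont := hφ.continuous
  have hW : ∀ c', ContDiff ℝ ∞ (vortFam 0 v c') := fun c' => contDiff_vortFam hv 0 c'
  have cL : Continuous (levelSq 1 v) := continuous_levelSq hv 1
  have cV : Continuous (vortSq 0 v) := continuous_vortSq hv 0
  have cG : Continuous fun x => Real.sqrt (levelSq 1 v x) * Real.sqrt (levelSq 1 v x) *
      Real.sqrt (vortSq 0 v x) :=
    ((Real.continuous_sqrt.comp cL).mul (Real.continuous_sqrt.comp cL)).mul
      (Real.continuous_sqrt.comp cV)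
  have iG : Integrable fun x => φ x ^ 4 * (Real.sqrt (levelSq 1 v x) * Real.sqrt (levelSq 1 v x) *
      Real.sqrt (vortSq 0 v x)) := integrable_pow_mul_of_continuous hφcont hφc cG (by norm_num)
  have hterm : ∀ c', 2 * ∫ x, φ x ^ 4 * (vortFam 0 v c' x * F c' x) ≤
      2 * CF * ∫ x, φ x ^ 4 * (Real.sqrt (levelSq 1 v x) * Real.sqrt (levelSq 1 v x) *
        Real.sqrt (vortSq 0 v x)) := by
    intro c'
    have i1 : Integrable fun x => φ x ^ 4 * (vortFam 0 v c' x * F c' x) :=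
      integrable_pow_mul_of_continuous hφcont hφc ((hW c').continuous.mul (hFc c')) (by norm_num)
    rw [mul_assoc, ← integral_const_mul CF]
    refine mul_le_mul_of_nonneg_left (integral_mono i1 (iG.const_mul CF) fun x => ?_) (by norm_num)
    have hsq : Real.sqrt (levelSq 1 v x) * Real.sqrt (levelSq 1 v x) = levelSq 1 v x :=
      Real.mul_self_sqrt (levelSq_nonneg 1 v x)
    have hΩ : |vortFam 0 v c' x| ≤ Real.sqrt (vortSq 0 v x) := by
      rw [← norm_famVec_vortFam]
      exact abs_famVec_apply_le _ x c'
    have h1 : vortFam 0 v c' x * F c' x ≤ Real.sqrt (vortSq 0 v x) * (CF * levelSq 1 v x) := by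
      calc vortFam 0 v c' x * F c' x ≤ |vortFam 0 v c' x * F c' x| := le_abs_self _
        _ = |vortFam 0 v c' x| * |F c' x| := abs_mul _ _
        _ ≤ Real.sqrt (vortSq 0 v x) * (CF * levelSq 1 v x) :=
            mul_le_mul hΩ (hF c' x) (abs_nonneg _) (Real.sqrt_nonneg _)
    simp only
    rw [hsq]
    have h4 : 0 ≤ φ x ^ 4 := pow_nonneg (hφ0 x) 4
    calc φ x ^ 4 * (vortFam 0 v c' x * F c' x)
        ≤ φ x ^ 4 * (Real.sqrt (vortSq 0 v x) * (CF * levelSq 1 v x)) :=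
          mul_le_mul_of_nonneg_left h1 h4
      _ = CF * (φ x ^ 4 * (levelSq 1 v x * Real.sqrt (vortSq 0 v x))) := by ring
  have hsum := Finset.sum_le_sum fun c' (_ : c' ∈ Finset.univ) => hterm c'
  rw [Finset.sum_const, Finset.card_univ, nsmul_eq_mul] at hsum
  refine hsum.trans (le_of_eq ?_)
  ring

/-- **The level-zero forcing terms.** Given `ν > 0`, the gradient bound `c`, `C_F ≥ 0` and a
global bound `S₁ ≥ ∫ |∇v|²`, there is `C` such that for every smooth divergence-free `v` obeying
this bound, every smooth compactly supported `0 ≤ φ ≤ 1` with `‖Dφ‖ ≤ c` and every continuous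
family `F` with `|F_{ki}| ≤ C_F |∇v|²` (the vortex stretching of the vorticity equation),
`∑ 2 ∫ φ⁴ Ω_{ki} F_{ki} ≤ (ν/4) ∫ φ⁴ |∇Ω|² + C (1 + ∫ φ⁴ |Ω|² + ∫ φ² |∇v|²)`: the cubic term
`∫ φ⁴|∇v|²|Ω|` is the trilinear Gagliardo–Nirenberg–Sobolev piece with global factor
`‖∇v‖₂ ≤ S₁^{1/2}`, the top-order factor `∫ φ⁴|∇²v|²` is returned to `∫ φ⁴|∇Ω|²` by the weighted
div–curl inequality, and the result is absorbed by `exists_eps_absorb_four`. [folklore] -/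
theorem forcing_term_le_zero {ν : ℝ} (c : ℝ) {CF : ℝ} (S₁ : ℝ) (hν : 0 < ν) (hCF : 0 ≤ CF) :
    ∃ C : ℝ, 0 ≤ C ∧ ∀ (v : EuclideanSpace ℝ (Fin 3) → EuclideanSpace ℝ (Fin 3))
      (φ : EuclideanSpace ℝ (Fin 3) → ℝ)
      (F : (Fin 0 → Fin 3) × Fin 3 × Fin 3 → EuclideanSpace ℝ (Fin 3) → ℝ),
      ContDiff ℝ ∞ v → (∀ x, ∑ i, pderiv i (fun y => v y i) x = 0) →
      ContDiff ℝ ∞ φ → HasCompactSupport φ → (∀ x, 0 ≤ φ x) → (∀ x, φ x ≤ 1) →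
      (∀ x, ‖fderiv ℝ φ x‖ ≤ c) → (∀ c', Continuous (F c')) →
      (∀ c' x, |F c' x| ≤ CF * levelSq 1 v x) →
      Integrable (levelSq 1 v) → (∫ x, levelSq 1 v x ≤ S₁) →
      ∑ c', 2 * ∫ x, φ x ^ 4 * (vortFam 0 v c' x * F c' x) ≤
        ν / 4 * (∫ x, φ x ^ 4 * vortSq 1 v x) +
          C * (1 + (∫ x, φ x ^ 4 * vortSq 0 v x) + ∫ x, φ x ^ 2 * levelSq 1 v x) := by
  have hK0 : 0 ≤ (((eLpNormLESNormFDerivOfEqInnerConst (volume : Measure (EuclideanSpace ℝ (Fin 3))) 2 : ℝ≥0) : ℝ)) :=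
    NNReal.coe_nonneg _
  obtain ⟨card, hcard⟩ : ∃ card : ℝ, card = (Fintype.card ((Fin 0 → Fin 3) × Fin 3 × Fin 3) : ℝ) :=
    ⟨_, rfl⟩
  have hcard0 : 0 ≤ card := hcard ▸ Nat.cast_nonneg _
  obtain ⟨ε, hε, C, hC0, hC⟩ := exists_eps_absorb_four
    (A := 2 * card * CF * (Real.sqrt S₁ *
      (((eLpNormLESNormFDerivOfEqInnerConst (volume : Measure (EuclideanSpace ℝ (Fin 3))) 2 : ℝ≥0) : ℝ)) ^ (3 / 2 : ℝ)))
    (p := 0) (q₀ := 0) (q₁ := 136 * c ^ 2) (by positivity) le_rfl le_rfl (by positivity) hν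
  refine ⟨C, hC0, fun v φ F hv hdiv hφ hφc hφ0 hφ1 hcφ hFc hF hint hSv => ?_⟩
  have hpφ : ∀ l x, |pderiv l φ x| ≤ c := fun l x => (abs_pderiv_le_norm_fderiv l φ x).trans (hcφ x)
  have hX0 : 0 ≤ ∫ x, φ x ^ 4 * vortSq 0 v x :=
    integral_nonneg fun x => mul_nonneg (pow_nonneg (hφ0 x) 4) (vortSq_nonneg _ _ _)
  have hD0 : 0 ≤ ∫ x, φ x ^ 4 * vortSq 1 v x :=
    integral_nonneg fun x => mul_nonneg (pow_nonneg (hφ0 x) 4) (vortSq_nonneg _ _ _)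
  have hY0 : 0 ≤ ∫ x, φ x ^ 2 * levelSq 1 v x :=
    integral_nonneg fun x => mul_nonneg (sq_nonneg _) (levelSq_nonneg _ _ _)
  -- weighted comparisons
  have hA4 : ∫ x, φ x ^ 4 * levelSq 1 v x ≤ ∫ x, φ x ^ 2 * levelSq 1 v x :=
    integral_pow_four_mul_le_integral_sq_mul (continuous_levelSq hv 1) (levelSq_nonneg 1 v)
      hφ hφc hφ0 hφ1
  have hWDC := integral_pow_four_mul_levelSq_succ_le hv hdiv hφ hφc hφ0 hpφ 1
  simp only [Fintype.card_fin] at hWDC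
  push_cast at hWDC
  have hB2 : ∫ x, φ x ^ 2 * vortSq 0 v x ≤ 4 * ∫ x, φ x ^ 2 * levelSq 1 v x :=
    integral_sq_mul_vortSq_le hv hφ hφc 0
  -- the trilinear piece
  have hpiece := forcing_trilinear_piece hv hφ hφc hφ0 hcφ hε 1 1 0 hint
  have hf2 : Real.sqrt (∫ x, levelSq 1 v x) ≤ Real.sqrt S₁ := Real.sqrt_le_sqrt hSv
  have hP : (∫ x, φ x ^ 4 * levelSq 1 v x) + ∫ x, φ x ^ 4 * vortSq 0 v x ≤
      0 + (∫ x, φ x ^ 2 * levelSq 1 v x) + ∫ x, φ x ^ 4 * vortSq 0 v x := by linarith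
  have hQ : (2 * (∫ x, φ x ^ 4 * levelSq (1 + 1) v x) + 8 * c ^ 2 * ∫ x, φ x ^ 2 * levelSq 1 v x) +
      (2 * (∫ x, φ x ^ 4 * vortSq (0 + 1) v x) + 8 * c ^ 2 * ∫ x, φ x ^ 2 * vortSq 0 v x) ≤
      4 * (∫ x, φ x ^ 4 * vortSq 1 v x) + 136 * c ^ 2 * (∫ x, φ x ^ 2 * levelSq 1 v x) + 0 := by
    simp only [Nat.zero_add] at hWDC ⊢
    nlinarith [hWDC, hB2, sq_nonneg c, hY0]
  have hP0 : 0 ≤ (∫ x, φ x ^ 4 * levelSq 1 v x) + ∫ x, φ x ^ 4 * vortSq 0 v x :=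
    add_nonneg (integral_nonneg fun x => mul_nonneg (pow_nonneg (hφ0 x) 4) (levelSq_nonneg _ _ _)) hX0
  have hQ0 : 0 ≤ (2 * (∫ x, φ x ^ 4 * levelSq (1 + 1) v x) + 8 * c ^ 2 * ∫ x, φ x ^ 2 * levelSq 1 v x) +
      (2 * (∫ x, φ x ^ 4 * vortSq (0 + 1) v x) + 8 * c ^ 2 * ∫ x, φ x ^ 2 * vortSq 0 v x) := by
    have i1 : 0 ≤ ∫ x, φ x ^ 4 * levelSq (1 + 1) v x :=
      integral_nonneg fun x => mul_nonneg (pow_nonneg (hφ0 x) 4) (levelSq_nonneg _ _ _)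
    have i2 : 0 ≤ ∫ x, φ x ^ 4 * vortSq (0 + 1) v x :=
      integral_nonneg fun x => mul_nonneg (pow_nonneg (hφ0 x) 4) (vortSq_nonneg _ _ _)
    have i3 : 0 ≤ ∫ x, φ x ^ 2 * vortSq 0 v x :=
      integral_nonneg fun x => mul_nonneg (sq_nonneg _) (vortSq_nonneg _ _ _)
    positivity
  have hi : 0 ≤ ε⁻¹ ^ 3 := by positivity
  have hbr : ∫ x, φ x ^ 4 * (Real.sqrt (levelSq 1 v x) * Real.sqrt (levelSq 1 v x) *
        Real.sqrt (vortSq 0 v x)) ≤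
      Real.sqrt S₁ * (((eLpNormLESNormFDerivOfEqInnerConst (volume : Measure (EuclideanSpace ℝ (Fin 3))) 2 : ℝ≥0) : ℝ)) ^ (3 / 2 : ℝ) *
        (1 / 8 * (ε⁻¹ ^ 3 * (0 + (∫ x, φ x ^ 2 * levelSq 1 v x) + ∫ x, φ x ^ 4 * vortSq 0 v x)) +
          3 / 8 * (ε * (4 * (∫ x, φ x ^ 4 * vortSq 1 v x) +
            136 * c ^ 2 * (∫ x, φ x ^ 2 * levelSq 1 v x) + 0))) := by
    refine hpiece.trans ?_
    have hbr0 : 0 ≤ 1 / 8 * (ε⁻¹ ^ 3 * ((∫ x, φ x ^ 4 * levelSq 1 v x) + ∫ x, φ x ^ 4 * vortSq 0 v x)) +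
        3 / 8 * (ε * ((2 * (∫ x, φ x ^ 4 * levelSq (1 + 1) v x) +
            8 * c ^ 2 * ∫ x, φ x ^ 2 * levelSq 1 v x) +
          (2 * (∫ x, φ x ^ 4 * vortSq (0 + 1) v x) + 8 * c ^ 2 * ∫ x, φ x ^ 2 * vortSq 0 v x))) := by
      positivity
    refine le_trans (mul_le_mul_of_nonneg_right (mul_le_mul_of_nonneg_right hf2 (by positivity))
      hbr0) ?_
    refine mul_le_mul_of_nonneg_left (add_le_add ?_ ?_) (by positivity)
    · exact mul_le_mul_of_nonneg_left (mul_le_mul_of_nonneg_left hP hi) (by norm_num)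
    · exact mul_le_mul_of_nonneg_left (mul_le_mul_of_nonneg_left hQ hε.le) (by norm_num)
  -- assemble
  have hred := forcing_reduction_zero hv hφ hφc hφ0 hFc hF
  rw [← hcard] at hred
  have hfin := hC _ _ _ hX0 hY0 hD0
  refine hred.trans (le_trans ?_ hfin)
  calc 2 * card * CF * ∫ x, φ x ^ 4 * (Real.sqrt (levelSq 1 v x) * Real.sqrt (levelSq 1 v x) *
          Real.sqrt (vortSq 0 v x))
      ≤ 2 * card * CF * (Real.sqrt S₁ * (((eLpNormLESNormFDerivOfEqInnerConst (volume : Measure (EuclideanSpace ℝ (Fin 3))) 2 : ℝ≥0) : ℝ)) ^ (3 / 2 : ℝ) *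
        (1 / 8 * (ε⁻¹ ^ 3 * (0 + (∫ x, φ x ^ 2 * levelSq 1 v x) + ∫ x, φ x ^ 4 * vortSq 0 v x)) +
          3 / 8 * (ε * (4 * (∫ x, φ x ^ 4 * vortSq 1 v x) +
            136 * c ^ 2 * (∫ x, φ x ^ 2 * levelSq 1 v x) + 0)))) :=
        mul_le_mul_of_nonneg_left hbr (by positivity)
    _ = _ := by ring


/-- **The level-zero slice energy inequality (core).** Given `ν > 0`, the cutoff gradient bound
`c ≥ 0`, the forcing constant `C_F ≥ 0` and global bounds `S₀`, `S₁`, there is `C₀` with the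
following property. Let `v` be smooth and divergence free with `∫ |v|² ≤ S₀`, `∫ |∇v|² ≤ S₁`,
`0 ≤ φ ≤ 1` smooth compactly supported with `‖Dφ‖ ≤ c`, `φ'` a companion cutoff (`= 1` where
`φ ≠ 0`), and `Ẇ_{ki}` continuous functions satisfying the vorticity equation in the form
`|Ẇ_{ki} − νΔΩ_{ki} + v·∇Ω_{ki}| ≤ C_F |∇v|²` pointwise. Then
`∑ 2 ∫ φ⁴ Ẇ_{ki} Ω_{ki} ≤ −ν ∫ φ⁴ |∇Ω|² + C₀ (1 + ∫ φ⁴ |Ω|² + ∫ φ² |∇v|²)`. [folklore] -/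
theorem slice_energy_inequality_core_zero {ν c CF S₀ S₁ : ℝ} (hν : 0 < ν) (hc : 0 ≤ c)
    (hCF : 0 ≤ CF) (hS₀ : 0 ≤ S₀) (hS₁ : 0 ≤ S₁) :
    ∃ C₀ : ℝ, 0 ≤ C₀ ∧ ∀ (v : EuclideanSpace ℝ (Fin 3) → EuclideanSpace ℝ (Fin 3))
      (φ φ' : EuclideanSpace ℝ (Fin 3) → ℝ)
      (Wdot : (Fin 0 → Fin 3) × Fin 3 × Fin 3 → EuclideanSpace ℝ (Fin 3) → ℝ),
      ContDiff ℝ ∞ v → (∀ x, ∑ i, pderiv i (fun y => v y i) x = 0) →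
      ContDiff ℝ ∞ φ → HasCompactSupport φ → (∀ x, 0 ≤ φ x) → (∀ x, φ x ≤ 1) →
      (∀ x, ‖fderiv ℝ φ x‖ ≤ c) →
      ContDiff ℝ ∞ φ' → HasCompactSupport φ' → (∀ x, 0 ≤ φ' x) → (∀ x, φ' x ≤ 1) →
      (∀ x, ‖fderiv ℝ φ' x‖ ≤ c) → (∀ x, φ x ≠ 0 → φ' x = 1) →
      (∀ c', Continuous (Wdot c')) →
      (∀ c' x, |Wdot c' x - ν * ∑ j, pderiv j (pderiv j (vortFam 0 v c')) x +
          ∑ j, v x j * pderiv j (vortFam 0 v c') x| ≤ CF * levelSq 1 v x) →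
      (Integrable fun x => ‖v x‖ ^ 2) → (∫ x, ‖v x‖ ^ 2 ≤ S₀) →
      Integrable (levelSq 1 v) → (∫ x, levelSq 1 v x ≤ S₁) →
      ∑ c', 2 * ∫ x, φ x ^ 4 * (Wdot c' x * vortFam 0 v c' x) ≤
        -ν * (∫ x, φ x ^ 4 * vortSq 1 v x) +
          C₀ * (1 + (∫ x, φ x ^ 4 * vortSq 0 v x) + ∫ x, φ x ^ 2 * levelSq 1 v x) := by
  obtain ⟨CT, hCT0, hCT⟩ := transport_term_le hν hc hS₀ hS₁ 0
  obtain ⟨CF', hCF'0, hCF'⟩ := forcing_term_le_zero c S₁ hν hCF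
  refine ⟨384 * ν * c ^ 2 + CT + CF', by positivity, fun v φ φ' Wdot hv hdiv hφ hφc hφ0 hφ1 hcφ hφ'
    hφ'c hφ'0 hφ'1 hcφ' hφφ' hWc hforce hv0 hS₀v hint hSv => ?_⟩
  have hpφ : ∀ l x, |pderiv l φ x| ≤ c := fun l x => (abs_pderiv_le_norm_fderiv l φ x).trans (hcφ x)
  have hφcont := hφ.continuous
  have hX0 : 0 ≤ ∫ x, φ x ^ 4 * vortSq 0 v x :=
    integral_nonneg fun x => mul_nonneg (pow_nonneg (hφ0 x) 4) (vortSq_nonneg _ _ _)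
  have hY0 : 0 ≤ ∫ x, φ x ^ 2 * levelSq 1 v x :=
    integral_nonneg fun x => mul_nonneg (sq_nonneg _) (levelSq_nonneg _ _ _)
  -- the per-component inequality, summed
  have hWsm : ∀ c', ContDiff ℝ ∞ (vortFam 0 v c') := fun c' => contDiff_vortFam hv 0 c'
  have hcomp := fun c' => component_pairing_le (hWsm c') (hWc c') hv hdiv hφ hφc hφ0 hpφ hν.le
    (Wdot := Wdot c')
  have hsum := Finset.sum_le_sum fun c' (_ : c' ∈ Finset.univ) => hcomp c'
  -- (1) the dissipation: `∑_c ∫ φ⁴ |∇W_c|² = ∫ φ⁴ |∇Ω|²`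
  have cdW : ∀ c' j, Continuous (pderiv j (vortFam 0 v c')) := fun c' j =>
    continuous_pderiv (hWsm c') (by simp) j
  have iA : ∀ c', Integrable fun x => φ x ^ 4 * ∑ j, pderiv j (vortFam 0 v c') x ^ 2 := fun c' =>
    integrable_pow_mul_of_continuous hφcont hφc
      (continuous_finsetSum _ fun j _ => (cdW c' j).pow 2) (by norm_num)
  have iB : ∀ c', Integrable fun x => φ x ^ 2 * vortFam 0 v c' x ^ 2 := fun c' =>
    integrable_pow_mul_of_continuous hφcont hφc ((hWsm c').continuous.pow 2) (by norm_num)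
  have e1 : ∑ c', ∫ x, φ x ^ 4 * ∑ j, pderiv j (vortFam 0 v c') x ^ 2 =
      ∫ x, φ x ^ 4 * vortSq (0 + 1) v x := by
    rw [← integral_finsetSum _ fun c' _ => iA c']
    refine integral_congr_ae (Eventually.of_forall fun x => ?_)
    simp only
    rw [← Finset.mul_sum, ← sum_sq_pderiv_vortFam 0 v x, Finset.sum_comm]
  -- (2) `∑_c ∫ φ² W_c² = ∫ φ² |Ω|² ≤ 4 Y`
  have e2 : ∑ c', ∫ x, φ x ^ 2 * vortFam 0 v c' x ^ 2 = ∫ x, φ x ^ 2 * vortSq 0 v x := by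
    rw [← integral_finsetSum _ fun c' _ => iB c']
    refine integral_congr_ae (Eventually.of_forall fun x => ?_)
    simp only
    rw [← Finset.mul_sum, sum_sq_vortFam]
  have h2 := integral_sq_mul_vortSq_le hv hφ hφc 0
  -- (3) the transport terms
  have cdφ : ∀ j, Continuous (pderiv j φ) := fun j => continuous_pderiv hφ (by simp) j
  have cV : ∀ j, Continuous fun y => v y j := fun j => (contDiff_comp_of_contDiff hv j).continuous
  have e3 : ∑ c', ∫ x, 4 * φ x ^ 3 * (∑ j, pderiv j φ x * v x j) * vortFam 0 v c' x ^ 2 =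
      ∫ x, 4 * φ x ^ 3 * (∑ j, pderiv j φ x * v x j) * vortSq 0 v x := by
    have hi : ∀ c', Integrable fun x => 4 * φ x ^ 3 * (∑ j, pderiv j φ x * v x j) *
        vortFam 0 v c' x ^ 2 := by
      intro c'
      have : (fun x => 4 * φ x ^ 3 * (∑ j, pderiv j φ x * v x j) * vortFam 0 v c' x ^ 2) =
          fun x => φ x ^ 3 * (4 * (∑ j, pderiv j φ x * v x j) * vortFam 0 v c' x ^ 2) := by
        funext x; ring
      rw [this]
      exact integrable_pow_mul_of_continuous hφcont hφc ((continuous_const.mul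
        (continuous_finsetSum _ fun j _ => (cdφ j).mul (cV j))).mul ((hWsm c').continuous.pow 2))
        (by norm_num)
    rw [← integral_finsetSum _ fun c' _ => hi c']
    refine integral_congr_ae (Eventually.of_forall fun x => ?_)
    simp only
    rw [← Finset.mul_sum, sum_sq_vortFam]
  have h3 := hCT v φ φ' hv hφ hφc hφ0 hφ1 hcφ hφ' hφ'c hφ'0 hφ'1 hcφ' hφφ' hv0 hS₀v hint hSv
  -- (4) the forcing terms
  have hF := hCF' v φ (fun c' x => Wdot c' x - ν * ∑ j, pderiv j (pderiv j (vortFam 0 v c')) x +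
      ∑ j, v x j * pderiv j (vortFam 0 v c') x) hv hdiv hφ hφc hφ0 hφ1 hcφ (fun c' => ?_) hforce
    hint hSv
  swap
  · exact ((hWc c').sub (continuous_const.mul (continuous_finsetSum _ fun j _ =>
      continuous_pderiv (contDiff_pderiv (hWsm c') j) (by simp) j))).add
      (continuous_finsetSum _ fun j _ => (cV j).mul (cdW c' j))
  -- assemble
  simp only [Finset.sum_add_distrib, ← Finset.mul_sum, e1, e2, e3] at hsum
  simp only [Nat.zero_add] at hsum h2 h3
  rw [← Finset.mul_sum] at hF ⊢
  have hc2 : 0 ≤ c ^ 2 := sq_nonneg c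
  nlinarith [hsum, h2, h3, hF, mul_nonneg hν.le hc2, mul_nonneg (mul_nonneg hν.le hc2) hY0,
    mul_nonneg hCT0 hX0, hCF'0]

end SliceZero

/-! ## Classical solutions: the level-zero slice inequality, Grönwall, exhaustion -/

section Solution

variable {T ν : ℝ} {u : ℝ → EuclideanSpace ℝ (Fin 3) → EuclideanSpace ℝ (Fin 3)}
  {p : ℝ → EuclideanSpace ℝ (Fin 3) → ℝ}

/-- The level-zero forcing sum of `abs_vorticity_forcing_le` is `|∇v|²`:
`∑_{a ∈ [1, 1]} |∇ᵃv| |∇^{2-a}v| = |∇v|²`. [folklore] -/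
theorem sum_Icc_one_one_sqrt_levelSq' (v : EuclideanSpace ℝ (Fin 3) → EuclideanSpace ℝ (Fin 3))
    (x : EuclideanSpace ℝ (Fin 3)) :
    ∑ a ∈ Finset.Icc 1 (0 + 1), Real.sqrt (levelSq a v x) * Real.sqrt (levelSq (0 + 2 - a) v x) =
      levelSq 1 v x := by
  rw [show (0 + 1 : ℕ) = 1 from rfl, Finset.Icc_self, Finset.sum_singleton]
  rw [show (0 + 2 - 1 : ℕ) = 1 from rfl, Real.mul_self_sqrt (levelSq_nonneg 1 v x)]

/-- **The level-zero slice energy inequality for classical solutions.** For an unforced classical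
solution on `[0, T] × ℝ³` (`ν > 0`) and nonnegative constants `S₀`, `S₁`, there is `C₀` such that
for all `R ≥ 1` and all `t ∈ [0, T]` at which `∫ |u(t)|² ≤ S₀` and `∫ |∇u(t)|² ≤ S₁`:
`∑ 2 ∫ χ_R⁴ ∂ₜΩ_{ki} Ω_{ki} ≤ −ν ∫ χ_R⁴ |∇Ω|² + C₀ (1 + ∫ χ_R⁴ |Ω|² + ∫ χ_R² |∇u|²)`
(the core inequality with `v = u(t)`, `Ẇ = ∂ₜΩ_{ki}` bounded through the vorticity equation
`abs_vorticity_forcing_le`, `φ = χ_R`, `φ' = χ_{2R}`). [folklore] -/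
theorem IsClassicalNSSolutionOn.slice_energy_inequality_zero
    (h : IsClassicalNSSolutionOn (Icc 0 T) ν 0 u p) (hν : 0 < ν) (hT : 0 < T) {S₀ S₁ : ℝ}
    (hS₀ : 0 ≤ S₀) (hS₁ : 0 ≤ S₁) :
    ∃ C₀ : ℝ, 0 ≤ C₀ ∧ ∀ R : ℝ, 1 ≤ R → ∀ t ∈ Icc 0 T,
      Integrable (levelSq 0 (u t)) → (∫ x, levelSq 0 (u t) x ≤ S₀) →
      Integrable (levelSq 1 (u t)) → (∫ x, levelSq 1 (u t) x ≤ S₁) →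
      ∑ c', 2 * ∫ x, cutoff R x ^ 4 *
          (FluidPDE.timeDerivWithin (Icc 0 T) (fun s y => vortFam 0 (u s) c' y) t x *
            vortFam 0 (u t) c' x) ≤
        -ν * (∫ x, cutoff R x ^ 4 * vortSq 1 (u t) x) +
          C₀ * (1 + (∫ x, cutoff R x ^ 4 * vortSq 0 (u t) x) +
            ∫ x, cutoff R x ^ 2 * levelSq 1 (u t) x) := by
  obtain ⟨c, hc0, hc⟩ := exists_norm_fderiv_cutoff_le (E := (EuclideanSpace ℝ (Fin 3)))
  have hCF : (0 : ℝ) ≤ 2 * 3 * 2 ^ (0 + 1) := by positivity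
  obtain ⟨C₀, hC₀0, hC₀⟩ := slice_energy_inequality_core_zero hν hc0 hCF hS₀ hS₁
  refine ⟨C₀, hC₀0, fun R hR t ht hint0 hS0v hint1 hS1v => ?_⟩
  have hR0 : 0 < R := by linarith
  have hU := uniqueDiffOn_Icc hT
  have hcl := Icc_subset_closure_interior hT
  have hv : ContDiff ℝ ∞ (u t) := h.contDiff_velocity ht
  have hdiv : ∀ x, ∑ i, pderiv i (fun y => u t y i) x = 0 := fun x => h.sum_pderiv_comp_eq_zero ht x
  -- the cutoffs
  have hgrad : ∀ {R'}, 1 ≤ R' → ∀ x, ‖fderiv ℝ (cutoff R') x‖ ≤ c := fun {R'} hR' x =>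
    (hc R' (by linarith) x).trans (div_le_self hc0 hR')
  -- the time derivatives
  have hWc : ∀ c', Continuous fun x =>
      FluidPDE.timeDerivWithin (Icc 0 T) (fun s y => vortFam 0 (u s) c' y) t x := fun c' =>
    (((h.isSmoothSpaceTimeOn_vortFam hT 0 c').timeDerivWithin hU).contDiff_slice ht).continuous
  have hforce : ∀ c' x, |FluidPDE.timeDerivWithin (Icc 0 T) (fun s y => vortFam 0 (u s) c' y) t x -
        ν * ∑ j, pderiv j (pderiv j (vortFam 0 (u t) c')) x +
        ∑ j, u t x j * pderiv j (vortFam 0 (u t) c') x| ≤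
      2 * 3 * 2 ^ (0 + 1) * levelSq 1 (u t) x := by
    intro c' x
    have := h.abs_vorticity_forcing_le hU hcl ht x c'.1 c'.2.1 c'.2.2
    rw [Fintype.card_fin, sum_Icc_one_one_sqrt_levelSq'] at this
    push_cast at this
    exact this
  -- level zero in the `‖·‖²` form
  have hv0 : Integrable fun x => ‖u t x‖ ^ 2 :=
    hint0.congr (Eventually.of_forall fun x => levelSq_zero_eq_norm_sq (u t) x)
  have hS₀v : ∫ x, ‖u t x‖ ^ 2 ≤ S₀ := by
    refine le_trans (le_of_eq ?_) hS0v
    exact integral_congr_ae (Eventually.of_forall fun x => (levelSq_zero_eq_norm_sq (u t) x).symm)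
  exact hC₀ (u t) (cutoff R) (cutoff (2 * R)) _ hv hdiv (contDiff_cutoff R)
    (hasCompactSupport_cutoff hR0) (cutoff_nonneg R) (cutoff_le_one R) (hgrad hR)
    (contDiff_cutoff (2 * R)) (hasCompactSupport_cutoff (by linarith)) (cutoff_nonneg (2 * R))
    (cutoff_le_one (2 * R)) (hgrad (by linarith)) (fun x hx => cutoff_two_mul_eq_one_of_ne hR0 hx)
    hWc hforce hv0 hS₀v hint1 hS1v

/-- **Uniform localised bounds at level zero (Grönwall).** For an unforced classical solution on
`[0, T] × ℝ³`, `ν > 0`: if `∫ |u(t)|² ≤ S₀` and `∫ |∇u(t)|² ≤ S₁` for `t ∈ [0, T]`, then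
`∫ χ_R⁴ |Ω(t)|²` and `∫₀ᵀ ∫ χ_R⁴ |∇Ω|²` are bounded uniformly in `R ≥ 1`, `t ∈ [0, T]` (integrate
the level-zero slice inequality in time and apply Grönwall; here `∫₀ᵀ∫ χ_R²|∇u|² ≤ T S₁` and
`∫ χ_R⁴|Ω(0)|² ≤ 4 S₁` come for free). [folklore] -/
theorem IsClassicalNSSolutionOn.uniform_enstrophy_bounds_zero
    (h : IsClassicalNSSolutionOn (Icc 0 T) ν 0 u p) (hν : 0 < ν) (hT : 0 < T) {S₀ S₁ : ℝ}
    (hS₀ : 0 ≤ S₀) (hS₁ : 0 ≤ S₁)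
    (hP0 : ∀ t ∈ Icc 0 T, Integrable (levelSq 0 (u t)) ∧ ∫ x, levelSq 0 (u t) x ≤ S₀)
    (hP1 : ∀ t ∈ Icc 0 T, Integrable (levelSq 1 (u t)) ∧ ∫ x, levelSq 1 (u t) x ≤ S₁) :
    ∃ M : ℝ, ∀ R, 1 ≤ R →
      (∀ t ∈ Icc 0 T, ∫ x, cutoff R x ^ 4 * vortSq 0 (u t) x ≤ M) ∧
        ∫ τ in Ioo 0 T, ∫ x, cutoff R x ^ 4 * vortSq 1 (u τ) x ≤ M := by
  obtain ⟨C₀, hC₀0, hC₀⟩ := h.slice_energy_inequality_zero hν hT hS₀ hS₁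
  -- the free bounds `I = T S₁`, `X₀ = 4 S₁`
  have hY_pt : ∀ R, 1 ≤ R → ∀ t ∈ Icc 0 T, ∫ x, cutoff R x ^ 2 * levelSq 1 (u t) x ≤ S₁ := by
    intro R hR t ht
    have hR0 : 0 < R := by linarith
    exact (integral_pow_mul_le_integral (continuous_levelSq (h.contDiff_velocity ht) 1)
      (levelSq_nonneg 1 _) (hP1 t ht).1 (contDiff_cutoff (E := (EuclideanSpace ℝ (Fin 3))) R)
      (hasCompactSupport_cutoff (E := (EuclideanSpace ℝ (Fin 3))) hR0) (cutoff_nonneg R)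
      (cutoff_le_one R) two_ne_zero).trans (hP1 t ht).2
  have h0T : (0 : ℝ) ∈ Icc 0 T := ⟨le_rfl, hT.le⟩
  have hu0 : ContDiff ℝ ∞ (u 0) := h.contDiff_velocity h0T
  have hX₀ : ∀ R, 1 ≤ R → ∫ x, cutoff R x ^ 4 * vortSq 0 (u 0) x ≤ 4 * S₁ := by
    intro R hR
    have hR0 : 0 < R := by linarith
    have hvort0 : Integrable (vortSq 0 (u 0)) := by
      refine ((hP1 0 h0T).1.const_mul 4).mono' (continuous_vortSq hu0 0).aestronglyMeasurable
        (Eventually.of_forall fun x => ?_)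
      rw [Real.norm_of_nonneg (vortSq_nonneg 0 _ x)]
      exact vortSq_le_four_mul_levelSq_succ hu0 0 x
    calc ∫ x, cutoff R x ^ 4 * vortSq 0 (u 0) x ≤ ∫ x, vortSq 0 (u 0) x :=
          integral_pow_mul_le_integral (continuous_vortSq hu0 0) (vortSq_nonneg 0 _) hvort0
            (contDiff_cutoff (E := (EuclideanSpace ℝ (Fin 3))) R)
            (hasCompactSupport_cutoff (E := (EuclideanSpace ℝ (Fin 3))) hR0)
            (cutoff_nonneg R) (cutoff_le_one R) (by norm_num)
      _ ≤ ∫ x, 4 * levelSq (0 + 1) (u 0) x :=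
          integral_mono hvort0 ((hP1 0 h0T).1.const_mul 4)
            fun x => vortSq_le_four_mul_levelSq_succ hu0 0 x
      _ = 4 * ∫ x, levelSq 1 (u 0) x := integral_const_mul _ _
      _ ≤ 4 * S₁ := by linarith [(hP1 0 h0T).2]
  set I : ℝ := T * S₁ with hIdef
  have hI0 : 0 ≤ I := by positivity
  set X₀ : ℝ := 4 * S₁ with hX₀def
  have hX₀0 : 0 ≤ X₀ := by positivity
  set A : ℝ := X₀ + C₀ * T + C₀ * I with hA
  have hA0 : 0 ≤ A := by positivity
  set M₁ : ℝ := A * Real.exp (C₀ * T) with hM₁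
  have hM₁0 : 0 ≤ M₁ := by positivity
  refine ⟨max M₁ ((A + C₀ * (T * M₁)) / ν), fun R hR => ?_⟩
  have hR0 : 0 < R := by linarith
  -- the four functions of time (opaque, with defining equations)
  obtain ⟨X, hX⟩ : ∃ X : ℝ → ℝ, X = fun t => ∫ x, cutoff R x ^ 4 * vortSq 0 (u t) x := ⟨_, rfl⟩
  obtain ⟨D, hD⟩ : ∃ D : ℝ → ℝ, D = fun t => ∫ x, cutoff R x ^ 4 * vortSq 1 (u t) x := ⟨_, rfl⟩
  obtain ⟨Y, hY⟩ : ∃ Y : ℝ → ℝ, Y = fun t => ∫ x, cutoff R x ^ 2 * levelSq 1 (u t) x := ⟨_, rfl⟩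
  obtain ⟨Φ, hΦ⟩ : ∃ Φ : ℝ → ℝ, Φ = fun t => ∑ c', 2 * ∫ x, cutoff R x ^ 4 *
      (FluidPDE.timeDerivWithin (Icc 0 T) (fun s y => vortFam 0 (u s) c' y) t x *
        vortFam 0 (u t) c' x) := ⟨_, rfl⟩
  have cX : ContinuousOn X (Icc 0 T) := by
    rw [hX]; exact h.continuousOn_integral_cutoff_pow_mul_vortSq hT hR0 4 0 (by norm_num)
  have cD : ContinuousOn D (Icc 0 T) := by
    rw [hD]; exact h.continuousOn_integral_cutoff_pow_mul_vortSq hT hR0 4 1 (by norm_num)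
  have cY : ContinuousOn Y (Icc 0 T) := by
    rw [hY]; exact h.continuousOn_integral_cutoff_pow_mul_levelSq hT hR0 2 1 (by norm_num)
  have cΦ : ContinuousOn Φ (Icc 0 T) := by
    rw [hΦ]
    exact continuousOn_finsetSum _ fun c' _ =>
      (h.continuousOn_integral_cutoff_pow_mul_timeDerivWithin_mul hT hR0 0 c').const_smul (2 : ℝ)
        |>.congr fun t _ => by simp [smul_eq_mul]
  have hX0' : ∀ t, 0 ≤ X t := fun t => by
    rw [hX]; exact integral_nonneg fun x =>
      mul_nonneg (pow_nonneg (cutoff_nonneg _ _) 4) (vortSq_nonneg _ _ _)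
  have hD0' : ∀ t, 0 ≤ D t := fun t => by
    rw [hD]; exact integral_nonneg fun x =>
      mul_nonneg (pow_nonneg (cutoff_nonneg _ _) 4) (vortSq_nonneg _ _ _)
  have hY0' : ∀ t, 0 ≤ Y t := fun t => by
    rw [hY]; exact integral_nonneg fun x => mul_nonneg (sq_nonneg _) (levelSq_nonneg _ _ _)
  -- the slice inequality and the time identity
  have hSEI : ∀ τ ∈ Icc 0 T, Φ τ ≤ -ν * D τ + C₀ * (1 + X τ + Y τ) := fun τ hτ => by
    rw [hΦ, hD, hX, hY]
    exact hC₀ R hR τ hτ (hP0 τ hτ).1 (hP0 τ hτ).2 (hP1 τ hτ).1 (hP1 τ hτ).2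
  have hFTC : ∀ t ∈ Icc 0 T, X t - X 0 = ∫ τ in Ioo 0 t, Φ τ := fun t ht => by
    rw [hX, hΦ]; exact h.integral_cutoff_vortSq_sub_eq hT hR0 0 ht
  -- integrate the slice inequality
  have hY_le : ∀ t ∈ Icc 0 T, ∫ τ in Ioo 0 t, Y τ ≤ I := fun t ht => by
    have iY := integrableOn_Ioo_of_continuousOn cY ht
    have i1 : IntegrableOn (fun _ => S₁) (Ioo 0 t) :=
      integrableOn_const (by rw [Real.volume_Ioo]; exact ENNReal.ofReal_ne_top)
    calc ∫ τ in Ioo 0 t, Y τ ≤ ∫ _ in Ioo 0 t, S₁ :=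
          setIntegral_mono_on iY i1 measurableSet_Ioo fun τ hτ => by
            rw [hY]; exact hY_pt R hR τ ⟨hτ.1.le, hτ.2.le.trans ht.2⟩
      _ = t * S₁ := by
          rw [setIntegral_const, Real.volume_real_Ioo, sub_zero, max_eq_left ht.1, smul_eq_mul]
      _ ≤ I := by rw [hIdef]; exact mul_le_mul_of_nonneg_right ht.2 hS₁
  have hmain : ∀ t ∈ Icc 0 T, X t + ν * ∫ τ in Ioo 0 t, D τ ≤ A + C₀ * ∫ τ in Ioo 0 t, X τ := by
    intro t ht
    have iΦ := integrableOn_Ioo_of_continuousOn cΦ ht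
    have iX := integrableOn_Ioo_of_continuousOn cX ht
    have iD := integrableOn_Ioo_of_continuousOn cD ht
    have iY := integrableOn_Ioo_of_continuousOn cY ht
    have i1 : IntegrableOn (fun _ => (1 : ℝ)) (Ioo 0 t) :=
      integrableOn_const (by rw [Real.volume_Ioo]; exact ENNReal.ofReal_ne_top)
    have i1X : IntegrableOn (fun τ => 1 + X τ) (Ioo 0 t) := i1.add iX
    have iXY : IntegrableOn (fun τ => 1 + X τ + Y τ) (Ioo 0 t) := i1X.add iY
    have iC : IntegrableOn (fun τ => C₀ * (1 + X τ + Y τ)) (Ioo 0 t) := iXY.const_mul _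
    have iνD : IntegrableOn (fun τ => -ν * D τ) (Ioo 0 t) := iD.const_mul _
    have iR : IntegrableOn (fun τ => -ν * D τ + C₀ * (1 + X τ + Y τ)) (Ioo 0 t) := iνD.add iC
    have hmono : ∫ τ in Ioo 0 t, Φ τ ≤ ∫ τ in Ioo 0 t, (-ν * D τ + C₀ * (1 + X τ + Y τ)) :=
      setIntegral_mono_on iΦ iR measurableSet_Ioo fun τ hτ =>
        hSEI τ ⟨hτ.1.le, hτ.2.le.trans ht.2⟩
    have e : ∫ τ in Ioo 0 t, (-ν * D τ + C₀ * (1 + X τ + Y τ)) =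
        -ν * (∫ τ in Ioo 0 t, D τ) + C₀ * (t + (∫ τ in Ioo 0 t, X τ) + ∫ τ in Ioo 0 t, Y τ) := by
      rw [integral_add iνD iC, integral_const_mul, integral_const_mul, integral_add i1X iY,
        integral_add i1 iX, setIntegral_const, Real.volume_real_Ioo, sub_zero, max_eq_left ht.1,
        smul_eq_mul, mul_one]
    have h1 := hFTC t ht
    have h2 := hY_le t ht
    have h3 : X 0 ≤ X₀ := by rw [hX]; exact hX₀ R hR
    have h4 : C₀ * t ≤ C₀ * T := mul_le_mul_of_nonneg_left ht.2 hC₀0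
    rw [hA]
    nlinarith [mul_le_mul_of_nonneg_left h2 hC₀0]
  -- Grönwall
  have hG : ∀ t ∈ Icc 0 T, X t ≤ A * Real.exp (C₀ * t) := by
    refine le_mul_exp_of_le_add_mul_integral cX hC₀0 fun t ht => ?_
    rw [intervalIntegral.integral_of_le ht.1, integral_Ioc_eq_integral_Ioo]
    have := hmain t ht
    have hD_int : 0 ≤ ∫ τ in Ioo 0 t, D τ := setIntegral_nonneg measurableSet_Ioo fun τ _ => hD0' τ
    nlinarith [mul_nonneg hν.le hD_int]
  have hXM : ∀ t ∈ Icc 0 T, X t ≤ M₁ := fun t ht =>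
    (hG t ht).trans (mul_le_mul_of_nonneg_left (Real.exp_le_exp.2
      (mul_le_mul_of_nonneg_left ht.2 hC₀0)) hA0)
  -- the dissipation
  have hTT : T ∈ Icc 0 T := ⟨hT.le, le_rfl⟩
  have hXint : ∫ τ in Ioo 0 T, X τ ≤ T * M₁ := by
    have iX := integrableOn_Ioo_of_continuousOn cX hTT
    have i1 : IntegrableOn (fun _ => M₁) (Ioo 0 T) :=
      integrableOn_const (by rw [Real.volume_Ioo]; exact ENNReal.ofReal_ne_top)
    calc ∫ τ in Ioo 0 T, X τ ≤ ∫ _ in Ioo 0 T, M₁ :=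
          setIntegral_mono_on iX i1 measurableSet_Ioo fun τ hτ => hXM τ ⟨hτ.1.le, hτ.2.le⟩
      _ = T * M₁ := by
          rw [setIntegral_const, Real.volume_real_Ioo, sub_zero, max_eq_left hT.le, smul_eq_mul]
  have hDM : ∫ τ in Ioo 0 T, D τ ≤ (A + C₀ * (T * M₁)) / ν := by
    rw [le_div_iff₀ hν]
    have := hmain T hTT
    nlinarith [hX0' T, mul_le_mul_of_nonneg_left hXint hC₀0]
  refine ⟨fun t ht => ?_, ?_⟩
  · have := hXM t ht
    rw [hX] at this
    exact this.trans (le_max_left _ _)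
  · rw [hD] at hDM
    exact hDM.trans (le_max_right _ _)

/-! ## Exhaustion in space–time -/

/-- Measurability in time of `t ↦ ∫_S |∇ᵐ u(t)|²` (`ℝ≥0∞`-valued) on `(0, T)`, for a measurable
set `S`: joint continuity of `(t, x) ↦ |∇ᵐu(t, x)|²` on the slab and Tonelli. [folklore] -/
theorem IsClassicalNSSolutionOn.aemeasurable_setLIntegral_levelSq
    (h : IsClassicalNSSolutionOn (Icc 0 T) ν 0 u p) (hT : 0 < T) (m : ℕ)
    {S : Set (EuclideanSpace ℝ (Fin 3))} (hS : MeasurableSet S) :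
    AEMeasurable (fun t => ∫⁻ x in S, ENNReal.ofReal (levelSq m (u t) x))
      ((volume : Measure ℝ).restrict (Ioo 0 T)) := by
  have hG := aestronglyMeasurable_prod_of_continuousOn (h.continuousOn_levelSq hT m)
  have hG' : AEMeasurable (fun z : ℝ × EuclideanSpace ℝ (Fin 3) => ENNReal.ofReal (levelSq m (u z.1) z.2))
      (((volume : Measure ℝ).restrict (Ioo 0 T)).prod (volume : Measure (EuclideanSpace ℝ (Fin 3)))) :=
    ENNReal.measurable_ofReal.comp_aemeasurable hG.aemeasurable
  have hind : AEMeasurable (fun z : ℝ × EuclideanSpace ℝ (Fin 3) =>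
      ((univ : Set ℝ) ×ˢ S).indicator (fun z => ENNReal.ofReal (levelSq m (u z.1) z.2)) z)
      (((volume : Measure ℝ).restrict (Ioo 0 T)).prod (volume : Measure (EuclideanSpace ℝ (Fin 3)))) :=
    hG'.indicator (MeasurableSet.univ.prod hS)
  refine (hind.lintegral_prod_right').congr (Eventually.of_forall fun t => ?_)
  simp only
  rw [← lintegral_indicator hS]
  refine lintegral_congr fun x => ?_
  by_cases hx : x ∈ S
  · rw [indicator_of_mem (mk_mem_prod (mem_univ _) hx), indicator_of_mem hx]
  · rw [indicator_of_notMem (fun hz => hx hz.2), indicator_of_notMem hx]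

/-- **Exhaustion in space–time.** If the localised `L²_t` norms are bounded uniformly in the
radius, `∫₀ᵀ ∫ χ_R² |∇ᵐu|² ≤ I` for all `R ≥ 1`, then `∫₀ᵀ ∫ |∇ᵐu|² ≤ I` as an iterated lower
Lebesgue integral (monotone convergence over the balls `B(0, n + 1)`, on which `χ_{n+1} = 1`).
[folklore] -/
theorem IsClassicalNSSolutionOn.lintegral_Ioo_lintegral_levelSq_le
    (h : IsClassicalNSSolutionOn (Icc 0 T) ν 0 u p) (hT : 0 < T) (m : ℕ) {I : ℝ}
    (hI : ∀ R : ℝ, 1 ≤ R → ∫ τ in Ioo 0 T, ∫ x, cutoff R x ^ 2 * levelSq m (u τ) x ≤ I) :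
    ∫⁻ t in Ioo 0 T, ∫⁻ x, ENNReal.ofReal (levelSq m (u t) x) ≤ ENNReal.ofReal I := by
  -- the truncated functionals `Z_n(t) = ∫_{B(0,n+1)} |∇ᵐu(t)|²`
  set Z : ℕ → ℝ → ℝ≥0∞ := fun n t =>
    ∫⁻ x in Metric.ball (0 : EuclideanSpace ℝ (Fin 3)) ((n : ℝ) + 1), ENNReal.ofReal (levelSq m (u t) x)
    with hZ
  have hTT : T ∈ Icc 0 T := ⟨hT.le, le_rfl⟩
  -- (1) `Z_n(t) ≤ ofReal (∫ χ_{n+1}² |∇ᵐu(t)|²)` for `t ∈ [0, T]`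
  have hZle : ∀ n : ℕ, ∀ t ∈ Icc 0 T,
      Z n t ≤ ENNReal.ofReal (∫ x, cutoff ((n : ℝ) + 1) x ^ 2 * levelSq m (u t) x) := by
    intro n t ht
    have hR0 : (0 : ℝ) < (n : ℝ) + 1 := by positivity
    have hv := h.contDiff_velocity ht
    have hint : Integrable fun x => cutoff ((n : ℝ) + 1) x ^ 2 * levelSq m (u t) x :=
      integrable_cutoff_pow_mul (continuous_levelSq hv m) hR0 two_ne_zero
    calc Z n t ≤ ∫⁻ x in Metric.ball (0 : EuclideanSpace ℝ (Fin 3)) ((n : ℝ) + 1),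
          ENNReal.ofReal (cutoff ((n : ℝ) + 1) x ^ 2 * levelSq m (u t) x) := by
          refine setLIntegral_mono' measurableSet_ball fun x hx => le_of_eq ?_
          rw [cutoff_eq_one hR0 (mem_ball_zero_iff.1 hx).le, one_pow, one_mul]
      _ ≤ ∫⁻ x, ENNReal.ofReal (cutoff ((n : ℝ) + 1) x ^ 2 * levelSq m (u t) x) :=
          setLIntegral_le_lintegral _ _
      _ = ENNReal.ofReal (∫ x, cutoff ((n : ℝ) + 1) x ^ 2 * levelSq m (u t) x) :=
          (ofReal_integral_eq_lintegral_ofReal hint (ae_of_all _ fun x =>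
            mul_nonneg (sq_nonneg _) (levelSq_nonneg m _ x))).symm
  -- (2) `∫₀ᵀ Z_n ≤ ofReal I`
  have hZint : ∀ n : ℕ, ∫⁻ t in Ioo 0 T, Z n t ≤ ENNReal.ofReal I := by
    intro n
    have hR0 : (0 : ℝ) < (n : ℝ) + 1 := by positivity
    have hR1 : (1 : ℝ) ≤ (n : ℝ) + 1 := by simp
    have cY := h.continuousOn_integral_cutoff_pow_mul_levelSq hT hR0 2 m two_ne_zero
    have iY := integrableOn_Ioo_of_continuousOn cY hTT
    have hY0 : ∀ t, 0 ≤ ∫ x, cutoff ((n : ℝ) + 1) x ^ 2 * levelSq m (u t) x := fun t =>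
      integral_nonneg fun x => mul_nonneg (sq_nonneg _) (levelSq_nonneg m _ x)
    calc ∫⁻ t in Ioo 0 T, Z n t
        ≤ ∫⁻ t in Ioo 0 T, ENNReal.ofReal (∫ x, cutoff ((n : ℝ) + 1) x ^ 2 * levelSq m (u t) x) :=
          setLIntegral_mono' measurableSet_Ioo fun t ht => hZle n t ⟨ht.1.le, ht.2.le⟩
      _ = ENNReal.ofReal (∫ t in Ioo 0 T, ∫ x, cutoff ((n : ℝ) + 1) x ^ 2 * levelSq m (u t) x) :=
          (ofReal_integral_eq_lintegral_ofReal iY (ae_of_all _ hY0)).symm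
      _ ≤ ENNReal.ofReal I := ENNReal.ofReal_le_ofReal (hI _ hR1)
  -- (3) monotone convergence in `n`
  have hmeas : ∀ n, AEMeasurable (Z n) ((volume : Measure ℝ).restrict (Ioo 0 T)) := fun n =>
    h.aemeasurable_setLIntegral_levelSq hT m measurableSet_ball
  have hmono : ∀ t, Monotone fun n => Z n t := fun t a b hab =>
    lintegral_mono_set (Metric.ball_subset_ball (by exact_mod_cast Nat.succ_le_succ hab))
  have hdir : Directed (· ⊆ ·) fun n : ℕ => Metric.ball (0 : EuclideanSpace ℝ (Fin 3)) ((n : ℝ) + 1) :=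
    Monotone.directed_le fun a b hab => Metric.ball_subset_ball (by exact_mod_cast Nat.succ_le_succ hab)
  have hsup : ∀ t, ∫⁻ x, ENNReal.ofReal (levelSq m (u t) x) = ⨆ n, Z n t := by
    intro t
    calc ∫⁻ x, ENNReal.ofReal (levelSq m (u t) x)
        = ∫⁻ x in ⋃ n : ℕ, Metric.ball (0 : EuclideanSpace ℝ (Fin 3)) ((n : ℝ) + 1),
            ENNReal.ofReal (levelSq m (u t) x) := by
          rw [Metric.iUnion_ball_nat_succ, Measure.restrict_univ]
      _ = ⨆ n : ℕ, Z n t := setLIntegral_iUnion_of_directed _ hdir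
  calc ∫⁻ t in Ioo 0 T, ∫⁻ x, ENNReal.ofReal (levelSq m (u t) x)
      = ∫⁻ t in Ioo 0 T, ⨆ n, Z n t := lintegral_congr fun t => hsup t
    _ = ⨆ n, ∫⁻ t in Ioo 0 T, Z n t := lintegral_iSup' hmeas (ae_of_all _ hmono)
    _ ≤ ENNReal.ofReal I := iSup_le hZint

/-- `‖D² v(x)‖ₑ² ≤ 27 · ofReal |∇²v(x)|²` pointwise for smooth `v` (operator norm of the second
Fréchet derivative versus the coordinate tensor). [folklore] -/
theorem enorm_iteratedFDeriv_two_sq_le {v : EuclideanSpace ℝ (Fin 3) → EuclideanSpace ℝ (Fin 3)}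
    (hv : ContDiff ℝ ∞ v) (x : EuclideanSpace ℝ (Fin 3)) :
    ‖iteratedFDeriv ℝ 2 v x‖ₑ ^ 2 ≤ 27 * ENNReal.ofReal (levelSq 2 v x) := by
  have h1 := sq_norm_iteratedFDeriv_le_pow_mul_levelSq hv 2 x
  rw [← ofReal_norm, ← ENNReal.ofReal_pow (norm_nonneg _),
    show (27 : ℝ≥0∞) = ENNReal.ofReal 27 by norm_num, ← ENNReal.ofReal_mul (by norm_num)]
  exact ENNReal.ofReal_le_ofReal (by norm_num at h1 ⊢; linarith)

/-! ## The main results -/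

/-- **Level bounds from the `H¹` hypotheses.** For a classical solution on `[0, T] × ℝ³` with
`sup_t ∫ |u(t)|² < ∞` and `sup_t ∫ ‖D¹u(t)‖² < ∞`, the coordinate tensors `|u(t)|² = |∇⁰u(t)|²` and
`|∇u(t)|²` are integrable with integrals bounded uniformly on `[0, T]`. [folklore] -/
theorem IsClassicalNSSolutionOn.levelSq_bounds_of_h1Bounded
    (h : IsClassicalNSSolutionOn (Icc 0 T) ν 0 u p)
    (hE : ∃ C : ℝ≥0, ∀ t ∈ Icc 0 T, ∫⁻ x, ‖u t x‖ₑ ^ 2 ≤ C)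
    (hH : ∃ C : ℝ≥0, ∀ t ∈ Icc 0 T, ∫⁻ x, ‖iteratedFDeriv ℝ 1 (u t) x‖ₑ ^ 2 ≤ C) :
    ∃ S₀ S₁ : ℝ, 0 ≤ S₀ ∧ 0 ≤ S₁ ∧
      (∀ t ∈ Icc 0 T, Integrable (levelSq 0 (u t)) ∧ ∫ x, levelSq 0 (u t) x ≤ S₀) ∧
      (∀ t ∈ Icc 0 T, Integrable (levelSq 1 (u t)) ∧ ∫ x, levelSq 1 (u t) x ≤ S₁) := by
  obtain ⟨C₀, hC₀⟩ := hE
  obtain ⟨C₁, hC₁⟩ := hH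
  refine ⟨3 ^ (0 + 1) * (C₀ : ℝ), 3 ^ (1 + 1) * (C₁ : ℝ), by positivity, by positivity,
    fun t ht => ?_, fun t ht => ?_⟩
  · have hv := h.contDiff_velocity ht
    have e : ∫⁻ x, ‖iteratedFDeriv ℝ 0 (u t) x‖ₑ ^ 2 = ∫⁻ x, ‖u t x‖ₑ ^ 2 :=
      lintegral_congr fun x => by rw [← ofReal_norm, ← ofReal_norm, norm_iteratedFDeriv_zero]
    have hfin : ∫⁻ x, ‖iteratedFDeriv ℝ 0 (u t) x‖ₑ ^ 2 < ⊤ := by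
      rw [e]; exact (hC₀ t ht).trans_lt ENNReal.coe_lt_top
    obtain ⟨hint, hle⟩ := integrable_levelSq_of_lintegral_lt_top hv 0 hfin
    refine ⟨hint, hle.trans (mul_le_mul_of_nonneg_left ?_ (by positivity))⟩
    rw [e]
    have := ENNReal.toReal_mono ENNReal.coe_ne_top (hC₀ t ht)
    simpa using this
  · have hv := h.contDiff_velocity ht
    have hfin : ∫⁻ x, ‖iteratedFDeriv ℝ 1 (u t) x‖ₑ ^ 2 < ⊤ := (hC₁ t ht).trans_lt ENNReal.coe_lt_top
    obtain ⟨hint, hle⟩ := integrable_levelSq_of_lintegral_lt_top hv 1 hfin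
    refine ⟨hint, hle.trans (mul_le_mul_of_nonneg_left ?_ (by positivity))⟩
    have := ENNReal.toReal_mono ENNReal.coe_ne_top (hC₁ t ht)
    simpa using this

/-- `∫₀ᵀ ∫ χ_R² |∇u|² ≤ T S₁` when `∫ |∇u(t)|² ≤ S₁` on `[0, T]`. [folklore] -/
theorem IsClassicalNSSolutionOn.integral_Ioo_cutoff_sq_levelSq_one_le
    (h : IsClassicalNSSolutionOn (Icc 0 T) ν 0 u p) (hT : 0 < T) {S₁ : ℝ}
    (hP1 : ∀ t ∈ Icc 0 T, Integrable (levelSq 1 (u t)) ∧ ∫ x, levelSq 1 (u t) x ≤ S₁)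
    {R : ℝ} (hR : 1 ≤ R) :
    ∫ τ in Ioo 0 T, ∫ x, cutoff R x ^ 2 * levelSq 1 (u τ) x ≤ T * S₁ := by
  have hR0 : 0 < R := by linarith
  have hTT : T ∈ Icc 0 T := ⟨hT.le, le_rfl⟩
  have cY := h.continuousOn_integral_cutoff_pow_mul_levelSq hT hR0 2 1 two_ne_zero
  have iY := integrableOn_Ioo_of_continuousOn cY hTT
  have i1 : IntegrableOn (fun _ => S₁) (Ioo 0 T) :=
    integrableOn_const (by rw [Real.volume_Ioo]; exact ENNReal.ofReal_ne_top)
  have hpt : ∀ t ∈ Icc 0 T, ∫ x, cutoff R x ^ 2 * levelSq 1 (u t) x ≤ S₁ := fun t ht =>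
    (integral_pow_mul_le_integral (continuous_levelSq (h.contDiff_velocity ht) 1)
      (levelSq_nonneg 1 _) (hP1 t ht).1 (contDiff_cutoff (E := (EuclideanSpace ℝ (Fin 3))) R)
      (hasCompactSupport_cutoff (E := (EuclideanSpace ℝ (Fin 3))) hR0) (cutoff_nonneg R)
      (cutoff_le_one R) two_ne_zero).trans (hP1 t ht).2
  calc ∫ τ in Ioo 0 T, ∫ x, cutoff R x ^ 2 * levelSq 1 (u τ) x ≤ ∫ _ in Ioo 0 T, S₁ :=
        setIntegral_mono_on iY i1 measurableSet_Ioo fun τ hτ => hpt τ ⟨hτ.1.le, hτ.2.le⟩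
    _ = T * S₁ := by
        rw [setIntegral_const, Real.volume_real_Ioo, sub_zero, max_eq_left hT.le, smul_eq_mul]

/-- **Dissipation of the vorticity gradient for `H¹`-bounded classical solutions.** For an
unforced classical solution `u` on `[0, T] × ℝ³` (`ν > 0`) with `sup_t ∫ |u(t)|² < ∞` and
`sup_t ∫ ‖D¹u(t)‖² < ∞`, the localised space–time integrals `∫₀ᵀ ∫ χ_R² |∇²u|²` are bounded
uniformly in `R ≥ 1` (the level-zero energy method: Grönwall for `∫ χ_R⁴|Ω|²`, dissipation
`∫₀ᵀ∫ χ_R⁴|∇Ω|²`, weighted div–curl). [folklore] -/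
theorem IsClassicalNSSolutionOn.dissipation_of_h1Bounded
    (h : IsClassicalNSSolutionOn (Icc 0 T) ν 0 u p) (hν : 0 < ν) (hT : 0 < T)
    (hE : ∃ C : ℝ≥0, ∀ t ∈ Icc 0 T, ∫⁻ x, ‖u t x‖ₑ ^ 2 ≤ C)
    (hH : ∃ C : ℝ≥0, ∀ t ∈ Icc 0 T, ∫⁻ x, ‖iteratedFDeriv ℝ 1 (u t) x‖ₑ ^ 2 ≤ C) :
    ∃ I : ℝ, ∀ R : ℝ, 1 ≤ R →
      ∫ τ in Ioo 0 T, ∫ x, cutoff R x ^ 2 * levelSq 2 (u τ) x ≤ I := by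
  obtain ⟨S₀, S₁, hS₀, hS₁, hP0, hP1⟩ := h.levelSq_bounds_of_h1Bounded hE hH
  obtain ⟨M, hM⟩ := h.uniform_enstrophy_bounds_zero hν hT hS₀ hS₁ hP0 hP1
  obtain ⟨c, -, hc⟩ := exists_abs_pderiv_cutoff_le
  refine ⟨M + 48 * c ^ 2 * (T * S₁), fun R hR => ?_⟩
  exact h.integral_Ioo_cutoff_levelSq_le_of_uniform hT hc (n := 0) (fun R' hR' => (hM R' hR').2)
    (fun R' hR' => h.integral_Ioo_cutoff_sq_levelSq_one_le hT hP1 hR') hR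

/-- **`∫₀ᵀ ∫ ‖D²u‖² < ∞` for `H¹`-bounded classical solutions** (`ν > 0`): the `L²_t H²_x` half of
Tao's class `X¹` is a consequence of the `L^∞_t H¹_x` half for classical solutions on the closed
slab. [folklore] -/
theorem IsClassicalNSSolutionOn.lintegral_iteratedFDeriv_two_lt_top_of_h1Bounded
    (h : IsClassicalNSSolutionOn (Icc 0 T) ν 0 u p) (hν : 0 < ν) (hT : 0 < T)
    (hE : ∃ C : ℝ≥0, ∀ t ∈ Icc 0 T, ∫⁻ x, ‖u t x‖ₑ ^ 2 ≤ C)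
    (hH : ∃ C : ℝ≥0, ∀ t ∈ Icc 0 T, ∫⁻ x, ‖iteratedFDeriv ℝ 1 (u t) x‖ₑ ^ 2 ≤ C) :
    (∫⁻ t in Ioo 0 T, ∫⁻ x, ‖iteratedFDeriv ℝ 2 (u t) x‖ₑ ^ 2) < ⊤ := by
  obtain ⟨I, hI⟩ := h.dissipation_of_h1Bounded hν hT hE hH
  have hfin := h.lintegral_Ioo_lintegral_levelSq_le hT 2 hI
  have hle : ∫⁻ t in Ioo 0 T, ∫⁻ x, ‖iteratedFDeriv ℝ 2 (u t) x‖ₑ ^ 2 ≤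
      ∫⁻ t in Ioo 0 T, 27 * ∫⁻ x, ENNReal.ofReal (levelSq 2 (u t) x) := by
    refine setLIntegral_mono' measurableSet_Ioo fun t ht => ?_
    have hv := h.contDiff_velocity ⟨ht.1.le, ht.2.le⟩
    rw [← lintegral_const_mul' _ _ (by norm_num)]
    exact lintegral_mono fun x => enorm_iteratedFDeriv_two_sq_le hv x
  refine lt_of_le_of_lt hle ?_
  rw [lintegral_const_mul' _ _ (by norm_num)]
  exact ENNReal.mul_lt_top (by norm_num) (hfin.trans_lt ENNReal.ofReal_lt_top)

/-- **`H¹`-bounded classical solutions lie in `X¹([0, T] × ℝ³)`** (`NS.MemSobolevX 1 T u`): the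
`L^∞_t` bounds on `u` and `D¹u` are the hypotheses, the `L²_t H²_x` bound is
`lintegral_iteratedFDeriv_two_lt_top_of_h1Bounded`. [folklore] -/
theorem IsClassicalNSSolutionOn.memSobolevX_of_h1Bounded
    (h : IsClassicalNSSolutionOn (Icc 0 T) ν 0 u p) (hν : 0 < ν) (hT : 0 < T)
    (hE : ∃ C : ℝ≥0, ∀ t ∈ Icc 0 T, ∫⁻ x, ‖u t x‖ₑ ^ 2 ≤ C)
    (hH : ∃ C : ℝ≥0, ∀ t ∈ Icc 0 T, ∫⁻ x, ‖iteratedFDeriv ℝ 1 (u t) x‖ₑ ^ 2 ≤ C) :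
    FluidPDE.MemSobolevX 1 T u := by
  refine ⟨fun j hj => ?_, h.lintegral_iteratedFDeriv_two_lt_top_of_h1Bounded hν hT hE hH⟩
  rcases Nat.le_one_iff_eq_zero_or_eq_one.1 hj with rfl | rfl
  · obtain ⟨C, hC⟩ := hE
    exact ⟨C, fun t ht => le_trans (le_of_eq (lintegral_congr fun x => by
      rw [← ofReal_norm, ← ofReal_norm, norm_iteratedFDeriv_zero])) (hC t ht)⟩
  · exact hH

/-! ## Instantaneous smoothing in the Sobolev scale for `H¹`-bounded classical solutions

From `∫₀ᵀ∫ |∇²u|² < ∞` almost every time is an `H²` time; restarting the persistence step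
`sobolev_step` of `NSEnstrophyPersistence` at such times (the system is autonomous) and iterating,
all Sobolev norms are bounded on `[ε, T]` for every `ε > 0`. -/

/-- Translation of set integrals over `Ioo` (Lebesgue measure is translation invariant); a local
copy, in the argument order used below, of the tree's `setIntegral_Ioo_comp_add_right`
(`LerayHopfRestart`, not imported here). [folklore] -/
private theorem setIntegral_Ioo_translate (F : ℝ → ℝ) (a c d : ℝ) :
    ∫ τ in Ioo c d, F (τ + a) = ∫ τ in Ioo (c + a) (d + a), F τ := by
  have h := (measurePreserving_add_right (volume : Measure ℝ) a).setIntegral_preimage_emb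
    (MeasurableEquiv.addRight a).measurableEmbedding F (Ioo (c + a) (d + a))
  simp only [preimage_add_const_Ioo, add_sub_cancel_right] at h
  exact h

/-- **Time translation on the closed slab**: a classical solution on `[0, T]` translated by
`a ∈ [0, T)` is a classical solution on `[0, T − a]`. [folklore] -/
theorem IsClassicalNSSolutionOn.translate_Icc_zero (h : IsClassicalNSSolutionOn (Icc 0 T) ν 0 u p)
    {a : ℝ} (ha : 0 ≤ a) (haT : a < T) :
    IsClassicalNSSolutionOn (Icc 0 (T - a)) ν 0 (fun t => u (t + a)) (fun t => p (t + a)) :=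
  (h.comp_add_right a).mono (fun t ht => ⟨by linarith [ht.1], by linarith [ht.2]⟩)
    (uniqueDiffOn_Icc (by linarith))

/-- The "levels from time `a` on" of the smoothing induction — uniform bounds on `∫ |∇ᵐu(t)|²`,
`m ≤ n`, for `t ∈ [a, T]`, and a bound on `∫ₐᵀ ∫ χ_R² |∇^{n+1}u|²` uniform in `R ≥ 1` — are
monotone in the starting time. [folklore] -/
theorem IsClassicalNSSolutionOn.sobolevLevels_mono
    (h : IsClassicalNSSolutionOn (Icc 0 T) ν 0 u p) (hT : 0 < T) {n : ℕ} {a b : ℝ} (ha : 0 ≤ a)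
    (hab : a ≤ b)
    (hL : ((∀ m ≤ n, ∃ S : ℝ, ∀ t ∈ Icc a T, Integrable (levelSq m (u t)) ∧ ∫ x, levelSq m (u t) x ≤ S) ∧
      ∃ I : ℝ, ∀ R : ℝ, 1 ≤ R →
        ∫ τ in Ioo a T, ∫ x, cutoff R x ^ 2 * levelSq (n + 1) (u τ) x ≤ I)) :
    ((∀ m ≤ n, ∃ S : ℝ, ∀ t ∈ Icc b T, Integrable (levelSq m (u t)) ∧ ∫ x, levelSq m (u t) x ≤ S) ∧
      ∃ I : ℝ, ∀ R : ℝ, 1 ≤ R →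
        ∫ τ in Ioo b T, ∫ x, cutoff R x ^ 2 * levelSq (n + 1) (u τ) x ≤ I) := by
  refine ⟨fun m hm => ?_, ?_⟩
  · obtain ⟨S, hS⟩ := hL.1 m hm
    exact ⟨S, fun t ht => hS t ⟨hab.trans ht.1, ht.2⟩⟩
  · obtain ⟨I, hI⟩ := hL.2
    refine ⟨I, fun R hR => le_trans ?_ (hI R hR)⟩
    have hR0 : 0 < R := by linarith
    have cY := h.continuousOn_integral_cutoff_pow_mul_levelSq hT hR0 2 (n + 1) two_ne_zero
    have iY : IntegrableOn (fun τ => ∫ x, cutoff R x ^ 2 * levelSq (n + 1) (u τ) x) (Ioo a T) :=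
      ((cY.mono (Icc_subset_Icc ha le_rfl)).integrableOn_compact isCompact_Icc).mono_set
        Ioo_subset_Icc_self
    exact setIntegral_mono_set iY (ae_of_all _ fun τ => integral_nonneg fun x =>
      mul_nonneg (sq_nonneg _) (levelSq_nonneg _ _ _)) (ae_of_all _ (Ioo_subset_Ioo hab le_rfl))

/-- **Good times.** If `∫ₐᵀ ∫ χ_R² |∇ᵏu|² ≤ I` for all `R ≥ 1` (`0 ≤ a < b ≤ T`), then some
`t₀ ∈ (a, b)` has `|∇ᵏu(t₀)|²` integrable (almost every time does). [folklore] -/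
theorem IsClassicalNSSolutionOn.exists_integrable_levelSq
    (h : IsClassicalNSSolutionOn (Icc 0 T) ν 0 u p) {a b : ℝ} (ha : 0 ≤ a) (hab : a < b)
    (hbT : b ≤ T) (k : ℕ) {I : ℝ}
    (hI : ∀ R : ℝ, 1 ≤ R → ∫ τ in Ioo a T, ∫ x, cutoff R x ^ 2 * levelSq k (u τ) x ≤ I) :
    ∃ t₀ ∈ Ioo a b, Integrable (levelSq k (u t₀)) := by
  have haT : a < T := hab.trans_le hbT
  have hT' : 0 < T - a := by linarith
  have h' := h.translate_Icc_zero ha haT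
  -- the bound in the translated frame
  have hI' : ∀ R : ℝ, 1 ≤ R →
      ∫ τ in Ioo 0 (T - a), ∫ x, cutoff R x ^ 2 * levelSq k (u (τ + a)) x ≤ I := by
    intro R hR
    have e := setIntegral_Ioo_translate
      (fun τ => ∫ x, cutoff R x ^ 2 * levelSq k (u τ) x) a 0 (T - a)
    rw [zero_add, sub_add_cancel] at e
    rw [e]
    exact hI R hR
  have hfin := h'.lintegral_Ioo_lintegral_levelSq_le hT' k hI'
  have hmeas : AEMeasurable (fun t => ∫⁻ x, ENNReal.ofReal (levelSq k (u (t + a)) x))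
      ((volume : Measure ℝ).restrict (Ioo 0 (T - a))) := by
    have := h'.aemeasurable_setLIntegral_levelSq hT' k MeasurableSet.univ
    simpa only [Measure.restrict_univ] using this
  have hae := ae_lt_top' hmeas (hfin.trans_lt ENNReal.ofReal_lt_top).ne
  -- a good time in `(0, b - a)`
  have hpos : 0 < (volume : Measure ℝ) (Ioo 0 (b - a)) := by
    rw [Real.volume_Ioo]; exact ENNReal.ofReal_pos.2 (by linarith)
  have hsub : Ioo 0 (b - a) ⊆ Ioo 0 (T - a) := Ioo_subset_Ioo le_rfl (by linarith)
  have hae' : ∀ᵐ t ∂(volume : Measure ℝ).restrict (Ioo 0 (b - a)),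
      ∫⁻ x, ENNReal.ofReal (levelSq k (u (t + a)) x) < ⊤ :=
    ae_restrict_of_ae_restrict_of_subset hsub hae
  haveI : (ae ((volume : Measure ℝ).restrict (Ioo 0 (b - a)))).NeBot := by
    refine ae_neBot.2 fun h0 => ?_
    rw [Measure.restrict_eq_zero] at h0
    exact hpos.ne' h0
  obtain ⟨τ₀, hτ₀, hτ₀f⟩ := ((ae_restrict_mem measurableSet_Ioo).and hae').exists
  refine ⟨τ₀ + a, ⟨by linarith [hτ₀.1], by linarith [hτ₀.2]⟩, ?_⟩
  have hv : ContDiff ℝ ∞ (u (τ₀ + a)) :=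
    h.contDiff_velocity ⟨by linarith [hτ₀.1], by linarith [hτ₀.2]⟩
  have hle : ∫⁻ x, ENNReal.ofReal (levelSq k (u (τ₀ + a)) x) ≤
      ENNReal.ofReal (∫⁻ x, ENNReal.ofReal (levelSq k (u (τ₀ + a)) x)).toReal := by
    rw [ENNReal.ofReal_toReal hτ₀f.ne]
  exact (integrable_and_integral_le_of_lintegral_ofReal_le (continuous_levelSq hv k)
    (levelSq_nonneg k _) ENNReal.toReal_nonneg hle).1

/-- **The persistence step restarted at a good time.** If the levels hold at order `n ≥ 1` from
time `a ≥ 0` on, then they hold at order `n + 1` from any later time `b ∈ (a, T)` on: pick a good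
time `t₀ ∈ (a, b)` with `∇^{n+1}u(t₀) ∈ L²` and apply `sobolev_step` to the translate `u(· + t₀)`
on `[0, T − t₀]`. [folklore] -/
theorem IsClassicalNSSolutionOn.sobolevLevels_succ
    (h : IsClassicalNSSolutionOn (Icc 0 T) ν 0 u p) (hν : 0 < ν) (hT : 0 < T) {n : ℕ} (hn : 1 ≤ n)
    {a b : ℝ} (ha : 0 ≤ a) (hab : a < b) (hbT : b < T)
    (hL : ((∀ m ≤ n, ∃ S : ℝ, ∀ t ∈ Icc a T, Integrable (levelSq m (u t)) ∧ ∫ x, levelSq m (u t) x ≤ S) ∧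
      ∃ I : ℝ, ∀ R : ℝ, 1 ≤ R →
        ∫ τ in Ioo a T, ∫ x, cutoff R x ^ 2 * levelSq (n + 1) (u τ) x ≤ I)) :
    ((∀ m ≤ (n + 1), ∃ S : ℝ, ∀ t ∈ Icc b T, Integrable (levelSq m (u t)) ∧ ∫ x, levelSq m (u t) x ≤ S) ∧
      ∃ I : ℝ, ∀ R : ℝ, 1 ≤ R →
        ∫ τ in Ioo b T, ∫ x, cutoff R x ^ 2 * levelSq ((n + 1) + 1) (u τ) x ≤ I) := by
  obtain ⟨hS, I, hI⟩ := hL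
  obtain ⟨t₀, ht₀, hdat⟩ := h.exists_integrable_levelSq ha hab hbT.le (n + 1) hI
  have ht₀0 : 0 ≤ t₀ := ha.trans ht₀.1.le
  have ht₀T : t₀ < T := ht₀.2.trans hbT
  have hT' : 0 < T - t₀ := by linarith
  have h' := h.translate_Icc_zero ht₀0 ht₀T
  -- hypotheses of `sobolev_step` in the translated frame
  have hdat' : Integrable (levelSq (n + 1) ((fun t => u (t + t₀)) 0)) := by
    simpa only [zero_add] using hdat
  have hPS' : ∀ m ≤ n, ∃ S : ℝ, ∀ t ∈ Icc 0 (T - t₀),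
      Integrable (levelSq m (u (t + t₀))) ∧ ∫ x, levelSq m (u (t + t₀)) x ≤ S := by
    intro m hm
    obtain ⟨S, hS'⟩ := hS m hm
    exact ⟨S, fun t ht => hS' (t + t₀) ⟨by linarith [ht.1, ht₀.1], by linarith [ht.2]⟩⟩
  have hPI' : ∃ I : ℝ, ∀ R, 1 ≤ R →
      ∫ τ in Ioo 0 (T - t₀), ∫ x, cutoff R x ^ 2 * levelSq (n + 1) (u (τ + t₀)) x ≤ I := by
    refine ⟨I, fun R hR => ?_⟩
    have e := setIntegral_Ioo_translate
      (fun τ => ∫ x, cutoff R x ^ 2 * levelSq (n + 1) (u τ) x) t₀ 0 (T - t₀)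
    rw [zero_add, sub_add_cancel] at e
    rw [e]
    refine le_trans ?_ (hI R hR)
    have hR0 : 0 < R := by linarith
    have cY := h.continuousOn_integral_cutoff_pow_mul_levelSq hT hR0 2 (n + 1) two_ne_zero
    have iY : IntegrableOn (fun τ => ∫ x, cutoff R x ^ 2 * levelSq (n + 1) (u τ) x) (Ioo a T) :=
      ((cY.mono (Icc_subset_Icc ha le_rfl)).integrableOn_compact isCompact_Icc).mono_set
        Ioo_subset_Icc_self
    exact setIntegral_mono_set iY (ae_of_all _ fun τ => integral_nonneg fun x =>
      mul_nonneg (sq_nonneg _) (levelSq_nonneg _ _ _)) (ae_of_all _ (Ioo_subset_Ioo ht₀.1.le le_rfl))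
  obtain ⟨⟨S₁, hS₁⟩, I₁, hI₁⟩ := h'.sobolev_step hν hT' hn hdat' hPS' hPI'
  refine ⟨fun m hm => ?_, ⟨I₁, fun R hR => ?_⟩⟩
  · rcases Nat.lt_or_ge m (n + 1) with hm' | hm'
    · obtain ⟨S, hS'⟩ := hS m (Nat.lt_succ_iff.1 hm')
      exact ⟨S, fun t ht => hS' t ⟨by linarith [ht.1], ht.2⟩⟩
    · have : m = n + 1 := le_antisymm hm hm'
      subst this
      refine ⟨S₁, fun t ht => ?_⟩
      have := hS₁ (t - t₀) ⟨by linarith [ht.1, ht₀.2], by linarith [ht.2]⟩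
      simpa only [sub_add_cancel] using this
  · have e := setIntegral_Ioo_translate
      (fun τ => ∫ x, cutoff R x ^ 2 * levelSq (n + 1 + 1) (u τ) x) t₀ 0 (T - t₀)
    rw [zero_add, sub_add_cancel] at e
    have hI₁' : ∫ τ in Ioo t₀ T, ∫ x, cutoff R x ^ 2 * levelSq (n + 1 + 1) (u τ) x ≤ I₁ := by
      rw [← e]; exact hI₁ R hR
    refine le_trans ?_ hI₁'
    have hR0 : 0 < R := by linarith
    have cY := h.continuousOn_integral_cutoff_pow_mul_levelSq hT hR0 2 (n + 1 + 1) two_ne_zero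
    have iY : IntegrableOn (fun τ => ∫ x, cutoff R x ^ 2 * levelSq (n + 1 + 1) (u τ) x) (Ioo t₀ T) :=
      ((cY.mono (Icc_subset_Icc ht₀0 le_rfl)).integrableOn_compact isCompact_Icc).mono_set
        Ioo_subset_Icc_self
    exact setIntegral_mono_set iY (ae_of_all _ fun τ => integral_nonneg fun x =>
      mul_nonneg (sq_nonneg _) (levelSq_nonneg _ _ _)) (ae_of_all _ (Ioo_subset_Ioo ht₀.2.le le_rfl))

/-- **All levels after any positive time.** For an `H¹`-bounded classical solution (`ν > 0`) and
every `n ≥ 1`, `b ∈ (0, T)`: the levels hold at order `n` from time `b` on (induction on `n`,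
restarting at `b/2`; the base case `n = 1` from time `0` is `dissipation_of_h1Bounded`). [folklore] -/
theorem IsClassicalNSSolutionOn.sobolevLevels_of_h1Bounded
    (h : IsClassicalNSSolutionOn (Icc 0 T) ν 0 u p) (hν : 0 < ν) (hT : 0 < T)
    (hE : ∃ C : ℝ≥0, ∀ t ∈ Icc 0 T, ∫⁻ x, ‖u t x‖ₑ ^ 2 ≤ C)
    (hH : ∃ C : ℝ≥0, ∀ t ∈ Icc 0 T, ∫⁻ x, ‖iteratedFDeriv ℝ 1 (u t) x‖ₑ ^ 2 ≤ C)
    (n : ℕ) (hn : 1 ≤ n) {b : ℝ} (hb : 0 < b) (hbT : b < T) :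
    ((∀ m ≤ n, ∃ S : ℝ, ∀ t ∈ Icc b T, Integrable (levelSq m (u t)) ∧ ∫ x, levelSq m (u t) x ≤ S) ∧
      ∃ I : ℝ, ∀ R : ℝ, 1 ≤ R →
        ∫ τ in Ioo b T, ∫ x, cutoff R x ^ 2 * levelSq (n + 1) (u τ) x ≤ I) := by
  induction n, hn using Nat.le_induction generalizing b with
  | base =>
      obtain ⟨S₀, S₁, -, -, hP0, hP1⟩ := h.levelSq_bounds_of_h1Bounded hE hH
      obtain ⟨I, hI⟩ := h.dissipation_of_h1Bounded hν hT hE hH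
      refine h.sobolevLevels_mono hT le_rfl hb.le ⟨fun m hm => ?_, ⟨I, hI⟩⟩
      rcases Nat.le_one_iff_eq_zero_or_eq_one.1 hm with rfl | rfl
      · exact ⟨S₀, hP0⟩
      · exact ⟨S₁, hP1⟩
  | succ n hn ih =>
      exact h.sobolevLevels_succ hν hT hn (by linarith : (0 : ℝ) ≤ b / 2) (by linarith) hbT
        (ih (by linarith) (by linarith))

/-- **Instantaneous Sobolev smoothing for `H¹`-bounded classical solutions.** An unforced
classical solution `u` on `[0, T] × ℝ³` (`ν > 0`) with `sup_t ∫|u(t)|² < ∞` and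
`sup_t ∫‖D¹u(t)‖² < ∞` has *all* Sobolev norms bounded on `[ε, T]` for every `ε ∈ (0, T)`:
`u ∈ L^∞([ε, T]; H^k)` for all `k` (`NS.HasBoundedSobolevNormsOn (Icc ε T) u`). This is the
classical parabolic smoothing, obtained here by restarting the `H^k`-persistence step of
`NSEnstrophyPersistence` at almost-every-time `H^k` data. [folklore] -/
theorem IsClassicalNSSolutionOn.hasBoundedSobolevNormsOn_of_h1Bounded
    (h : IsClassicalNSSolutionOn (Icc 0 T) ν 0 u p) (hν : 0 < ν) (hT : 0 < T)
    (hE : ∃ C : ℝ≥0, ∀ t ∈ Icc 0 T, ∫⁻ x, ‖u t x‖ₑ ^ 2 ≤ C)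
    (hH : ∃ C : ℝ≥0, ∀ t ∈ Icc 0 T, ∫⁻ x, ‖iteratedFDeriv ℝ 1 (u t) x‖ₑ ^ 2 ≤ C)
    {ε : ℝ} (hε : 0 < ε) (hεT : ε < T) : HasBoundedSobolevNormsOn (Icc ε T) u := by
  intro k
  obtain ⟨hS, -⟩ := h.sobolevLevels_of_h1Bounded hν hT hE hH (max k 1) (le_max_right _ _) hε hεT
  obtain ⟨S, hSk⟩ := hS k (le_max_left _ _)
  refine ⟨(3 ^ (k + 1) * S).toNNReal, fun t ht => ?_⟩
  have hv := h.contDiff_velocity ⟨hε.le.trans ht.1, ht.2⟩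
  refine (lintegral_sq_norm_iteratedFDeriv_le hv k (hSk t ht).1).trans ?_
  rw [← ENNReal.ofReal_coe_nnreal, Real.coe_toNNReal']
  exact ENNReal.ofReal_le_ofReal (le_trans (mul_le_mul_of_nonneg_left (hSk t ht).2 (by positivity))
    (le_max_left _ _))

end Solution

end Literature.Analysis.FluidPDE

end
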